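import Mathlib
import Summits.Ventures.HodgeRepro.Tier4.Common.AdelicDefs
import Summits.Ventures.HodgeRepro.Tier4.Line1.RationalPoints
import Summits.Ventures.HodgeRepro.Tier4.Line1.LocallyCompactGA
import Summits.Ventures.HodgeRepro.Tier4.Line1.PrincipalDiscrete
import Summits.Ventures.HodgeRepro.Tier4.Line1.QuadraticAdeleHaar
import Summits.Ventures.HodgeRepro.Tier4.Line1.PairBlichfeldt

/-!
# Tier4/Line1/TorusFujisaki — Fujisaki for the norm-one torus `{(x, y) ∈ 𝔸_k² : x² + d y² = 1}` (hstab-(ii))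

Blind re-derivation cell `pub-hodge-repro`, Tier 4 (README §9–§10), seat t4-L1-p2 (prover, LINE L1, gen 0).
Support for the cocompactness cut R-c of LINE L1 (t4-L1-p5's rung file `I1c-rungs-sig.lean`; p3's S12799 residual
(ii) of `hstab`, my S12847): FUJISAKI FOR THE NORM-ONE TORUS `{(x, y) ∈ 𝔸_k² : x² + d y² = 1}`, proved WITHOUT
absolute values, place decompositions or idele topologies.  `𝔸_k[Ω]` (`Ω² = −d`) is Mathlib's
`QuadraticAlgebra (𝔸_k) (−d) 0`; pairs `𝔸_k × 𝔸_k` carry the topology and the Haar measure, `equivProd` moves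
between the two.  HC_CM is NOT proved by anyone in this repository.

CONTENT (module 3 of 3): the rational elements `a + bΩ`, `(a, b) ∈ k²` (norm, product, conjugate, non-vanishing of
the norm when `−d` is not a square), and the THEOREM `exists_compact_normOne_eq_rational_mul`: there is a compact
`C ⊆ 𝔸_k²` of norm-one pairs with `N¹ = N¹(k) · C`.  PROOF (F5): for `z ∈ N¹`, Blichfeldt on `C₁ z̄` (measure
`μ C₁ > c₀` by (F1)) gives a non-zero rational `x` with `x z ∈ C₂ := C₁ − C₁`; `N(x) = N(x z) ∈ k ∩ N(C₂)`, a finite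
set `F₂`; with a fixed rational `x_a` of each norm `a ∈ F₂`, `γ := a⁻¹ x̄_a x` is rational of norm one and
`z = γ̄ · (γ z)` with `γ z = (a⁻¹ x̄_a) · (x z) ∈ (a⁻¹ x̄_a) C₂`; so `C := N¹ ∩ ⋃_{a ∈ F₂} (a⁻¹ x̄_a) C₂` works.
The classical second application to `z⁻¹` is not needed: `N¹` carries the subspace topology of `𝔸_k²` and inversion
on it is the continuous conjugation.  Consumer: hstab for `Stab(v)(𝔸_k)` through p3's identification (rung (i)).
-/

set_option autoImplicit false

noncomputable section

namespace Summit.Ventures.HodgeRepro.Tier4.Line1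

open NumberField MeasureTheory Measure Topology Common Set QuadraticAlgebra
open scoped ENNReal NNReal

section RationalElements

variable {k : Type} [Field k] [NumberField k] (d : k)

/-- the norm of a rational element `a + bΩ` of `𝔸_k[Ω]` is the rational `a² + d b²` -/
theorem norm_rat (a b : k) :
    norm (⟨algebraMap k (Ad k) a, algebraMap k (Ad k) b⟩ :
      QuadraticAlgebra (Ad k) (-(algebraMap k (Ad k) d)) 0) = algebraMap k (Ad k) (a * a + d * (b * b)) := by
  rw [norm_def]
  simp only [map_add, map_mul]
  ring

/-- the product of two rational elements is rational -/
theorem rat_mul_rat (a b a' b' : k) :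
    (⟨algebraMap k (Ad k) a, algebraMap k (Ad k) b⟩ : QuadraticAlgebra (Ad k) (-(algebraMap k (Ad k) d)) 0) *
      ⟨algebraMap k (Ad k) a', algebraMap k (Ad k) b'⟩ =
      ⟨algebraMap k (Ad k) (a * a' - d * (b * b')), algebraMap k (Ad k) (a * b' + b * a')⟩ := by
  ext
  · simp only [re_mul, map_sub, map_mul]
    ring
  · simp only [im_mul, map_add, map_mul]
    ring

/-- the conjugate of a rational element is rational -/
theorem star_rat (a b : k) :
    star (⟨algebraMap k (Ad k) a, algebraMap k (Ad k) b⟩ :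
      QuadraticAlgebra (Ad k) (-(algebraMap k (Ad k) d)) 0) =
      ⟨algebraMap k (Ad k) a, algebraMap k (Ad k) (-b)⟩ := by
  ext
  · simp only [re_star, zero_mul, add_zero]
  · simp only [im_star, map_neg]

omit [NumberField k] in
/-- a non-zero rational element has non-zero norm when `−d` is not a square in `k` -/
theorem rat_norm_ne_zero (hd : ¬ IsSquare (-d)) {a b : k} (hab : a ≠ 0 ∨ b ≠ 0) :
    a * a + d * (b * b) ≠ 0 := by
  intro h
  by_cases hb : b = 0
  · subst hb
    have ha : a ≠ 0 := by
      rcases hab with ha | hb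
      · exact ha
      · exact absurd rfl hb
    apply ha
    have : a * a = 0 := by simpa using h
    exact mul_self_eq_zero.1 this
  · apply hd
    refine ⟨a / b, ?_⟩
    field_simp
    linear_combination -h

/-- right multiplication by an algebra element, on pairs (the rational element on the left) -/
theorem equivProd_mul_symm (w : QuadraticAlgebra (Ad k) (-(algebraMap k (Ad k) d)) 0) (p : Ad k × Ad k) :
    equivProd (-(algebraMap k (Ad k) d)) 0 (w * (equivProd (-(algebraMap k (Ad k) d)) 0).symm p) =
      (w.re * p.1 - algebraMap k (Ad k) d * (w.im * p.2), w.re * p.2 + w.im * p.1) := by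
  show ((w * (equivProd (-(algebraMap k (Ad k) d)) 0).symm p).re,
    (w * (equivProd (-(algebraMap k (Ad k) d)) 0).symm p).im) = _
  simp only [re_mul, im_mul, equivProd_symm_apply, zero_mul, add_zero]
  refine Prod.ext ?_ ?_
  · show _ = _
    ring
  · rfl

/-- the map `p ↦ w · p` on pairs is continuous -/
theorem continuous_equivProd_mul_symm (w : QuadraticAlgebra (Ad k) (-(algebraMap k (Ad k) d)) 0) :
    Continuous fun p : Ad k × Ad k =>
      equivProd (-(algebraMap k (Ad k) d)) 0 (w * (equivProd (-(algebraMap k (Ad k) d)) 0).symm p) := by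
  simp only [equivProd_mul_symm]
  exact ((continuous_const.mul continuous_fst).sub
    (continuous_const.mul (continuous_const.mul continuous_snd))).prodMk
    ((continuous_const.mul continuous_snd).add (continuous_const.mul continuous_fst))

/-- the norm of a pair, as a continuous function -/
theorem continuous_norm_equivProd_symm :
    Continuous fun p : Ad k × Ad k => norm ((equivProd (-(algebraMap k (Ad k) d)) 0).symm p) := by
  have : (fun p : Ad k × Ad k => norm ((equivProd (-(algebraMap k (Ad k) d)) 0).symm p)) =
      fun p => p.1 * p.1 + algebraMap k (Ad k) d * (p.2 * p.2) := by
    funext p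
    rw [norm_def]
    simp only [equivProd_symm_apply]
    ring
  rw [this]
  exact (continuous_fst.mul continuous_fst).add (continuous_const.mul (continuous_snd.mul continuous_snd))

/-- the norm-one locus is closed in `𝔸_k²` -/
theorem isClosed_normOne :
    IsClosed {p : Ad k × Ad k | norm ((equivProd (-(algebraMap k (Ad k) d)) 0).symm p) = 1} := by
  haveI := t2Space_adeleRing k
  exact isClosed_eq (continuous_norm_equivProd_symm d) continuous_const

/-- `equivProd.symm` is compatible with subtraction -/
theorem equivProd_symm_sub (p q : Ad k × Ad k) :
    (equivProd (-(algebraMap k (Ad k) d)) 0).symm (p - q) =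
      (equivProd (-(algebraMap k (Ad k) d)) 0).symm p - (equivProd (-(algebraMap k (Ad k) d)) 0).symm q := rfl

omit [NumberField k] in
/-- the norm of `𝔸_k[Ω]` restricted to rational pairs is multiplicative (a polynomial identity in `k`) -/
theorem rat_norm_mul (a b a' b' : k) :
    (a * a' - d * (b * b')) * (a * a' - d * (b * b')) + d * ((a * b' + b * a') * (a * b' + b * a')) =
      (a * a + d * (b * b)) * (a' * a' + d * (b' * b')) := by ring

end RationalElements

section Assembly

variable {k : Type} [Field k] [NumberField k] (d : k)

/-- **(F5) Fujisaki for the norm-one torus of `𝔸_k[Ω]`, given a Haar measure on `𝔸_k²`**: there is a compact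
set `C` of norm-one pairs such that every norm-one `z ∈ 𝔸_k[Ω]` is a RATIONAL norm-one element times an element
of `C`.  Proof: Blichfeldt on `C₁ z̄` (its measure is `μ C₁ > c₀` by the Haar invariance (F1)) gives a non-zero
rational `x` with `x z ∈ C₂ = C₁ − C₁`; `N(x) = N(x z) ∈ k ∩ N(C₂)`, a finite set; with a fixed rational `x_a` of
norm `a = N(x)`, `γ := a⁻¹ x̄_a x` is rational of norm one and `z = γ̄ · (γ z)` with `γ z = (a⁻¹ x̄_a) · (x z)` in
the compact `(a⁻¹ x̄_a) C₂`. -/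
theorem exists_compact_normOne_eq_rational_mul_of_measure [MeasurableSpace (Ad k × Ad k)]
    [BorelSpace (Ad k × Ad k)] (μ : Measure (Ad k × Ad k)) [μ.IsAddHaarMeasure] (hd : ¬ IsSquare (-d)) :
    ∃ C : Set (Ad k × Ad k), IsCompact C ∧
      (∀ c ∈ C, norm ((equivProd (-(algebraMap k (Ad k) d)) 0).symm c) = 1) ∧
      ∀ z : QuadraticAlgebra (Ad k) (-(algebraMap k (Ad k) d)) 0, norm z = 1 →
        ∃ a b : k, a * a + d * (b * b) = 1 ∧ ∃ c ∈ C,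
          z = ⟨algebraMap k (Ad k) a, algebraMap k (Ad k) b⟩ *
            (equivProd (-(algebraMap k (Ad k) d)) 0).symm c := by
  classical
  haveI := t2Space_adeleRing k
  -- (F2), (F3)
  obtain ⟨c₀, hc₀, hB⟩ := exists_ne_zero_rational_mem_sub_pair k μ
  obtain ⟨C₁, hC₁, hμC₁⟩ := exists_isCompact_lt_measure_pair k μ c₀ hc₀
  -- `C₂ := C₁ − C₁`
  let C₂ : Set (Ad k × Ad k) := (fun q : (Ad k × Ad k) × (Ad k × Ad k) => q.1 - q.2) '' (C₁ ×ˢ C₁)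
  have hC₂ : IsCompact C₂ := (hC₁.prod hC₁).image (continuous_fst.sub continuous_snd)
  -- the finite set of rational norms met by `C₂`
  let F₂ : Set k := {a : k | algebraMap k (Ad k) a ∈
    (fun p : Ad k × Ad k => norm ((equivProd (-(algebraMap k (Ad k) d)) 0).symm p)) '' C₂}
  have hF₂ : F₂.Finite :=
    finite_principal_inter_of_isCompact k (hC₂.image (continuous_norm_equivProd_symm d))
  -- a rational pair of each rational norm that is a norm
  let xa : k → k × k := fun a =>
    if h : ∃ x : k × k, x.1 * x.1 + d * (x.2 * x.2) = a then Classical.choose h else (0, 0)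
  have hxa : ∀ a : k, (∃ x : k × k, x.1 * x.1 + d * (x.2 * x.2) = a) →
      (xa a).1 * (xa a).1 + d * ((xa a).2 * (xa a).2) = a := by
    intro a h
    simp only [xa, dif_pos h]
    exact Classical.choose_spec h
  -- the rational multipliers `m a := a⁻¹ · conj (x_a)`
  let m : k → QuadraticAlgebra (Ad k) (-(algebraMap k (Ad k) d)) 0 := fun a =>
    ⟨algebraMap k (Ad k) (a⁻¹ * (xa a).1), algebraMap k (Ad k) (a⁻¹ * (-(xa a).2))⟩
  let C : Set (Ad k × Ad k) :=
    {p | norm ((equivProd (-(algebraMap k (Ad k) d)) 0).symm p) = 1} ∩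
      ⋃ a ∈ F₂, (fun p => equivProd (-(algebraMap k (Ad k) d)) 0
        (m a * (equivProd (-(algebraMap k (Ad k) d)) 0).symm p)) '' C₂
  refine ⟨C, ?_, fun c hc => hc.1, ?_⟩
  · exact (hF₂.isCompact_biUnion fun a _ =>
      hC₂.image (continuous_equivProd_mul_symm d (m a))).inter_left (isClosed_normOne d)
  · intro z hz
    -- Blichfeldt on `S := C₁ z̄`
    have hzs : norm (star z) = 1 := by rw [QuadraticAlgebra.norm_star, hz]
    let S : Set (Ad k × Ad k) := (fun p => equivProd (-(algebraMap k (Ad k) d)) 0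
      ((equivProd (-(algebraMap k (Ad k) d)) 0).symm p * star z)) '' C₁
    have hS : IsCompact S := hC₁.image (continuous_equivProd_symm_mul d (star z))
    have hμS : c₀ < μ S := by
      have := measure_image_mul_normOne d μ (star z) hzs C₁
      rw [this]
      exact hμC₁
    obtain ⟨a, b, hab, s, hs, t, ht, hst⟩ := hB S hS.measurableSet hμS
    obtain ⟨s', hs', rfl⟩ := hs
    obtain ⟨t', ht', rfl⟩ := ht
    -- `x := a + bΩ`; `x z = s' − t' ∈ C₂`
    have hbb : s' - t' ∈ C₂ := ⟨(s', t'), ⟨hs', ht'⟩, rfl⟩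
    have hxz : (⟨algebraMap k (Ad k) a, algebraMap k (Ad k) b⟩ :
        QuadraticAlgebra (Ad k) (-(algebraMap k (Ad k) d)) 0) * z =
        (equivProd (-(algebraMap k (Ad k) d)) 0).symm (s' - t') := by
      have h1 : (⟨algebraMap k (Ad k) a, algebraMap k (Ad k) b⟩ :
          QuadraticAlgebra (Ad k) (-(algebraMap k (Ad k) d)) 0) =
          (equivProd (-(algebraMap k (Ad k) d)) 0).symm (algebraMap k (Ad k) a, algebraMap k (Ad k) b) := rfl
      rw [h1, ← hst, equivProd_symm_sub, Equiv.symm_apply_apply, Equiv.symm_apply_apply,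
        equivProd_symm_sub, ← sub_mul, mul_assoc, mul_comm (star z) z, ← algebraMap_norm_eq_mul_star, hz,
        map_one, mul_one]
    -- the norm `n₀` of `x`
    have hn₀ : a * a + d * (b * b) ≠ 0 := rat_norm_ne_zero d hd hab
    have hnorm_bb : norm ((equivProd (-(algebraMap k (Ad k) d)) 0).symm (s' - t')) =
        algebraMap k (Ad k) (a * a + d * (b * b)) := by
      rw [← hxz, map_mul, hz, mul_one, norm_rat]
    have hmem : a * a + d * (b * b) ∈ F₂ := ⟨s' - t', hbb, hnorm_bb⟩
    have hex : ∃ x : k × k, x.1 * x.1 + d * (x.2 * x.2) = a * a + d * (b * b) := ⟨(a, b), rfl⟩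
    have hx₀ := hxa _ hex
    -- `γ := m n₀ · x`, rational of norm one
    set n₀ : k := a * a + d * (b * b) with hn₀def
    set a' : k := (n₀⁻¹ * (xa n₀).1) * a - d * ((n₀⁻¹ * (-(xa n₀).2)) * b) with ha'
    set b' : k := (n₀⁻¹ * (xa n₀).1) * b + (n₀⁻¹ * (-(xa n₀).2)) * a with hb'
    have hγ : m n₀ * ⟨algebraMap k (Ad k) a, algebraMap k (Ad k) b⟩ =
        (⟨algebraMap k (Ad k) a', algebraMap k (Ad k) b'⟩ :
          QuadraticAlgebra (Ad k) (-(algebraMap k (Ad k) d)) 0) := by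
      show (⟨algebraMap k (Ad k) (n₀⁻¹ * (xa n₀).1), algebraMap k (Ad k) (n₀⁻¹ * (-(xa n₀).2))⟩ :
        QuadraticAlgebra (Ad k) (-(algebraMap k (Ad k) d)) 0) * ⟨algebraMap k (Ad k) a, algebraMap k (Ad k) b⟩ = _
      rw [rat_mul_rat]
    have hγnorm : a' * a' + d * (b' * b') = 1 := by
      rw [ha', hb', rat_norm_mul]
      have h2 : (n₀⁻¹ * (xa n₀).1) * (n₀⁻¹ * (xa n₀).1) + d * ((n₀⁻¹ * (-(xa n₀).2)) * (n₀⁻¹ * (-(xa n₀).2))) =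
          n₀⁻¹ * n₀⁻¹ * ((xa n₀).1 * (xa n₀).1 + d * ((xa n₀).2 * (xa n₀).2)) := by ring
      rw [h2, hx₀, ← hn₀def]
      field_simp
    -- `κ := γ z`
    refine ⟨a', -b', by rw [neg_mul_neg]; exact hγnorm, ?_⟩
    refine ⟨equivProd (-(algebraMap k (Ad k) d)) 0
      (m n₀ * (equivProd (-(algebraMap k (Ad k) d)) 0).symm (s' - t')), ⟨?_, ?_⟩, ?_⟩
    · -- norm one
      show norm ((equivProd (-(algebraMap k (Ad k) d)) 0).symm (equivProd (-(algebraMap k (Ad k) d)) 0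
        (m n₀ * (equivProd (-(algebraMap k (Ad k) d)) 0).symm (s' - t')))) = 1
      rw [Equiv.symm_apply_apply, ← hxz, ← mul_assoc, hγ, map_mul, hz, mul_one, norm_rat, hγnorm, map_one]
    · -- in the union
      exact Set.mem_biUnion hmem ⟨s' - t', hbb, rfl⟩
    · -- `z = γ̄ · κ`
      rw [Equiv.symm_apply_apply, ← hxz, ← mul_assoc (m n₀), hγ]
      have hstar : (⟨algebraMap k (Ad k) a', algebraMap k (Ad k) (-b')⟩ :
          QuadraticAlgebra (Ad k) (-(algebraMap k (Ad k) d)) 0) =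
          star ⟨algebraMap k (Ad k) a', algebraMap k (Ad k) b'⟩ := (star_rat d a' b').symm
      rw [hstar, ← mul_assoc, mul_comm (star _) _, ← algebraMap_norm_eq_mul_star, norm_rat, hγnorm, map_one,
        map_one, one_mul]

end Assembly

section Final

variable {k : Type} [Field k] [NumberField k] (d : k)

/-- **FUJISAKI FOR THE NORM-ONE TORUS `{(x, y) ∈ 𝔸_k² : x² + d y² = 1}` (hstab-(ii) of LINE L1's R-c cut; the
base case R-c′ of the Mostow–Tamagawa induction).**  For `d ∈ k` with `−d` not a square, there is a compact set
`C ⊆ 𝔸_k²` of norm-one pairs such that every norm-one pair `z` is the product (in `𝔸_k[Ω]`, `Ω² = −d`, i.e.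
`(a, b) · (x, y) = (a x − d b y, a y + b x)`) of a RATIONAL norm-one pair `(a, b) ∈ k²` and an element of `C`:
the rational points of the torus are cocompact.  Absolute-value-free proof: Haar invariance through involutions
(`map_mul_normOne_eq_self`), adelic Blichfeldt (`exists_ne_zero_rational_mem_sub_pair`), the finiteness of
`k ∩ (compact)` (`finite_principal_inter_of_isCompact`); no place decomposition, no idele topology. -/
theorem exists_compact_normOne_eq_rational_mul (hd : ¬ IsSquare (-d)) :
    ∃ C : Set (Ad k × Ad k), IsCompact C ∧
      (∀ c ∈ C, c.1 * c.1 + algebraMap k (Ad k) d * (c.2 * c.2) = 1) ∧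
      ∀ z : Ad k × Ad k, z.1 * z.1 + algebraMap k (Ad k) d * (z.2 * z.2) = 1 →
        ∃ a b : k, a * a + d * (b * b) = 1 ∧ ∃ c ∈ C,
          z = (algebraMap k (Ad k) a * c.1 - algebraMap k (Ad k) d * (algebraMap k (Ad k) b * c.2),
            algebraMap k (Ad k) a * c.2 + algebraMap k (Ad k) b * c.1) := by
  letI : MeasurableSpace (Ad k × Ad k) := borel _
  haveI : BorelSpace (Ad k × Ad k) := ⟨rfl⟩
  haveI := locallyCompactSpace_adeleRing k
  let μ : Measure (Ad k × Ad k) := Measure.addHaar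
  obtain ⟨C, hC, hC1, hmain⟩ := exists_compact_normOne_eq_rational_mul_of_measure d μ hd
  refine ⟨C, hC, fun c hc => ?_, fun z hz => ?_⟩
  · have := hC1 c hc
    rwa [norm_equivProd_symm] at this
  · have hz' : norm ((equivProd (-(algebraMap k (Ad k) d)) 0).symm z) = 1 := by
      rw [norm_equivProd_symm]
      exact hz
    obtain ⟨a, b, hab, c, hc, heq⟩ := hmain _ hz'
    refine ⟨a, b, hab, c, hc, ?_⟩
    have h1 := congrArg (equivProd (-(algebraMap k (Ad k) d)) 0) heq
    rw [Equiv.apply_symm_apply, equivProd_mul_symm] at h1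
    exact h1

end Final

end Summit.Ventures.HodgeRepro.Tier4.Line1

end
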